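import Summits.QuantumFields.YangMills.Theorems.BalabanUVNodesN22W1StripMixed
import Summits.QuantumFields.YangMills.Theorems.BalabanUVNodesN22W1StripN18EdgeOfRecord

/-!
# BalabanUVNodes ∕ node N22 = NE9 — THE STRIP INDUCTION AT THE W1 OBJECT, MODULE 11: THE LAST COUPLING BY NAME — module 8's output-level socket `hlast`
# DISCHARGED by node00-def-W1 g3's `lastOut_of_eHoloAt` (node N09's per-step currency `B12BetaHolo.EHoloAt` on the tower of W1's terms `sfTowerOfRecord`),
# so that STRIP-(1.18) at the spaces of record follows from the OLDER-coupling level-T hypothesis + an `EHoloAt` family along the window + numerals, and the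
# ₁₂ edge of modules 9∕10 runs end to end from named neighbours' currencies

Cell `pub-ymgap`, HUMAN RULING D-0062 (Track A), R134 ACCELERATION re-seat `pub-ymgap-dag-n22-c` (strategy s1), generation 3, module 11 = trigger (t2) of the seat's
HANDOFF («a W1 ↔ `SFTower` dictionary lands ⇒ `hlast` adapter from `EHoloAt`»), fired by node00-def-W1 g3's `Node00/RateRecordW1Maps.lean` (p473218 ✓ 85fb888b543f:
`sfTowerOfRecord Sg Rz M S fl logZ : Step.SFTower` with `E (k+1) X t φ = termC S (k+1) X (update fl.g k t) φ` and spaces `Sect2.spaceI Sg Rz M j (domSites …) α₀ α₁`;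
`lastOut_of_eHoloAt`).  THEOREMS ONLY; imports module 8 `…N22W1StripMixed` (p468953: the MIXED level-T producer `stripBound_termC_of_termwise226StripOlder_lastOut`)
and module 10 `…N22W1StripN18EdgeOfRecord` (p477488: the ₁₂ edge at `ReadingData.ofRecord`) BY NAME.  `--supports` K3′ (helper).

WHY.  Module 8 splits the level-T one-step hypothesis of the strip induction by the age of the complexified coupling: the OLDER couplings `i < k` (read through
the old terms only — [II] (2.15) p. 15, node N10's lane) keep the termwise-(2.26)-on-the-strip hypothesis, while the LAST coupling `i = k` is served by an
OUTPUT-LEVEL letter `hlast` — STRIP(k+1, k) directly: a holomorphic extension of `t ↦ E^{(k+1)}(X; g₀,…,g_{k−1}, t; φ)` to an open set containing the closed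
`r`-discs about `]0, γ]` with `‖·‖ ≤ E₀e^{−κ d_{k+1}(X)}` — which is [I] p. 263's «(or analytic)» clause in the last coupling with (1.18) on the complex
neighbourhood, i.e. node N09's `EHoloAt` (print: [H-dil] ∕ [I] pp. 266–267).  node00-def-W1 g3's `lastOut_of_eHoloAt` delivers exactly this shape at the space
table OF RECORD `U^c_j(X, α₀, α₁) = spaceI Sg Rz M j (domSites …) c.α₀ c.α₁` from ONE `EHoloAt (sfTowerOfRecord Sg Rz M S ⟨g, β⟩ logZ) c k` per admissible history
`g ∈ ]0, γ]^ℕ` (`γ ≤ c.γ`) and step `k` with uniform letters (`H.E₀ ≤ E₀`, `r ≤ H.r`).  So at the spaces of record the last coupling is BY NAME, and N22's residual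
at the W1 reading of record reads: the older-coupling level-T hypothesis (N10), an `EHoloAt` family (N09's currency), `S_N18` (N18), the junk-freeness pin, the
readings inside the spaces (Theorem 1), and numerals.

WHAT.
* §1 `hlast_of_eHoloAt` — module 8's `hlast` at `sp := U^c of record` with decay `κ ≤ c.κ` from the `EHoloAt` family (`lastOut_of_eHoloAt` + monotonicity in `κ`);
  `stripBound_termC_of_termwise226StripOlder_eHoloAt` — STRIP AT EVERY LEVEL IN EVERY COUPLING at the spaces of record from the older-coupling level-T hypothesis
  + the `EHoloAt` family + the socket numerals + S25's clauses + the renewal (module 8 §2 with `hlast` DISCHARGED).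
* §2 `n22At_u3OfRecord₁₂_ofRecord_of_n18Below_termwise226StripOlder_eHoloAt` — AT THE READING DATA OF RECORD (module 10): `N22At` at the level-`k` Stage-12 bundle
  of `ReadingData.ofRecord F M N S gauge hg T₀ li` from the older-coupling level-T hypothesis for `S k` + an `EHoloAt` family on `sfTowerOfRecord Sg Rz M (S k) ⟨g, β⟩ logZ`
  + `∀ k′ < k, N18At (…)` + (J) + readings `(ιU, 0) ∈ U^c` + numerals (`θ.γ ≤ c.γ`, `li.κ ≤ c.κ` among them).

HONEST FRAMING.  Count-neutral by-name knit; NOT a discharge of N22: the older-coupling level-T hypothesis ([II] (2.15)–(2.26) per term READ ON THE STRIP of an OLDER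
coupling — NOT PRINTED as such; inspection-level) and the `EHoloAt` family (node N09's statement shape on W1's terms — a hypothesis here, NOT PROVED) are DISPLAYED;
`S_N18` is node N18's stub; (J) a reading pin; readings-in-the-spaces is Theorem-1 content; the numerals are the reading's; no inhabitant of `IsDatumOfRecord₁₂C`
claimed (K0′).  NE5 ∕ NE9 NOT IN PRINT; one finite four-torus programme at fixed ε — NOT infinite volume, NOT OS on ℝ⁴, NOT a mass gap, NOT Clay.  0 `sorry`, 0 `def`,
standard axioms.

References (TYPES only): [I] = [Balaban1987RG1] (1.7) p. 261, (1.11)–(1.16) p. 262, (1.18) p. 263 with the clause before it, pp. 266–267; [II] = [Balaban1988RG2Cluster]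
(2.13)–(2.15) pp. 14–15, (2.26) p. 17, (2.38)–(2.41) pp. 20–21.
-/

noncomputable section

open scoped Matrix.Norms.L2Operator

namespace YMDAG.N22.W1

open Set Metric
open scoped BigOperators
open Literature.MathematicalPhysics.QuantumFieldTheory.Balaban1983to89
open Literature.MathematicalPhysics.QuantumFieldTheory.Balaban1983to89.T4Continuum
open Literature.MathematicalPhysics.QuantumFieldTheory.Balaban1983to89.T4OutputRate
open Literature.MathematicalPhysics.QuantumFieldTheory.Balaban1983to89.TreeLengthTorus (TPt TDom tsys torusTreeLen torusTreeLen_nonneg)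
open Literature.MathematicalPhysics.QuantumFieldTheory.Balaban1983to89.B12TreeDecay (K₀ K₀_pos)
open Literature.MathematicalPhysics.QuantumFieldTheory.Balaban1983to89.B13Lemma3TorusData (TBond)
open Literature.MathematicalPhysics.QuantumFieldTheory.Balaban1983to89.B13Lemma3TorusTerms (terms weight)
open Literature.MathematicalPhysics.QuantumFieldTheory.Balaban1983to89.B13Lemma3TorusSocket (Lemma3Numerics)
open Literature.MathematicalPhysics.QuantumFieldTheory.Balaban1983to89.B12BetaHolo (EHoloAt)
open Literature.MathematicalPhysics.QuantumFieldTheory.Balaban1983to89.Step (SFConsts)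
open Literature.MathematicalPhysics.QuantumFieldTheory.Balaban1983to89.Node00
  (Stage12Params IsDatumOfRecord₁₂C U3Objects₁₁ U3Letters₁₁ MatA ιSU prependCoupling)
open Literature.MathematicalPhysics.QuantumFieldTheory.Balaban1983to89.Node00.Sect2 (domSys domCount CPair ofBackgroundC spaceI domSites Setting Residual)
open Literature.MathematicalPhysics.QuantumFieldTheory.Balaban1983to89.Node00.W1
open YMDAG.UVSplit

variable {N : ℕ} [NeZero N]

/-! ## §1 Module 8's last-coupling socket from an `EHoloAt` family on the tower of W1's terms, at the spaces of record -/

section LastCoupling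

variable (F : T4Family) (K : ℕ) {𝔸 : Type*} [NormedRing 𝔸] [NormedAlgebra ℂ 𝔸] [CompleteSpace 𝔸] {G : Type*} [GaugeGroup G] {M : ℕ}
  (Sg : Setting 𝔸 G) (Rz : Residual (F.P K) 𝔸) (logZ : ℕ → GaugeField (F.P K) 0 G → ℝ) (β : ℕ → ℝ → ℝ)

omit [NeZero N] in
open Classical in
/-- **MODULE 8's `hlast` FROM AN `EHoloAt` FAMILY** (node00-def-W1 g3's `lastOut_of_eHoloAt`, decay weakened from `c.κ` to any `κ ≤ c.κ`): at the space table of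
record `sp j Y := U^c_j(Y, c.α₀, c.α₁)`, one `EHoloAt (sfTowerOfRecord Sg Rz M S ⟨g, β⟩ logZ) c k` per window history `g ∈ ]0, γ]^ℕ` (`γ ≤ c.γ`) and step `k` with
`H.E₀ ≤ E₀`, `r ≤ H.r` gives STRIP(k+1, k) at every `(g, X, φ ∈ U^c_{k+1}(X))` — the inductive premise of the socket is not needed.
[cite: Balaban1987RG1, p.263 (clause before (1.18)) with pp.266-267] -/
theorem hlast_of_eHoloAt (S : ClusterTower (F.P K) 𝔸 M) {c : SFConsts} {γ r E₀ κ : ℝ} (hγ : γ ≤ c.γ) (hκ : κ ≤ c.κ) (hE₀ : 0 ≤ E₀)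
    (hE : ∀ g ∈ Window γ, ∀ k : ℕ, ∃ H : EHoloAt (sfTowerOfRecord Sg Rz M S ⟨g, β⟩ logZ) c k, H.E₀ ≤ E₀ ∧ r ≤ H.r) :
    ∀ (k : ℕ) (g : ℕ → ℝ), g ∈ Window γ → ∀ (X : (domSys (F.P K) M (k + 1)).Dom) (φ : CPair (F.P K) 𝔸),
      φ ∈ spaceI Sg Rz M (k + 1) (domSites (F.P K) M (k + 1) X) c.α₀ c.α₁ →
      (∀ (j : ℕ), j < k + 1 → ∀ (Y : (domSys (F.P K) M j).Dom) (ψ : CPair (F.P K) 𝔸), ψ ∈ spaceI Sg Rz M j (domSites (F.P K) M j Y) c.α₀ c.α₁ →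
        ∃ (Ec : ℂ → ℂ) (O : Set ℂ), IsOpen O ∧ (∀ t ∈ Ioc (0 : ℝ) γ, closedBall (t : ℂ) r ⊆ O) ∧ DifferentiableOn ℂ Ec O ∧
          (∀ z ∈ O, ‖Ec z‖ ≤ E₀ * Real.exp (-(κ * torusTreeLen Y.1))) ∧
          (∀ t ∈ Ioc (0 : ℝ) γ, Ec t = termC S j Y (Function.update g k t) ψ)) →
      ∃ (Ec : ℂ → ℂ) (O : Set ℂ), IsOpen O ∧ (∀ t ∈ Ioc (0 : ℝ) γ, closedBall (t : ℂ) r ⊆ O) ∧ DifferentiableOn ℂ Ec O ∧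
        (∀ z ∈ O, ‖Ec z‖ ≤ E₀ * Real.exp (-(κ * torusTreeLen X.1))) ∧
        (∀ t ∈ Ioc (0 : ℝ) γ, Ec t = termC S (k + 1) X (Function.update g k t) φ) := by
  intro k g hg X φ hφ _
  obtain ⟨Ec, O, hO, hdisc, hhol, hbd, hrep⟩ := lastOut_of_eHoloAt Sg Rz M S logZ β hγ hE k g hg X φ hφ
  refine ⟨Ec, O, hO, hdisc, hhol, fun z hz => (hbd z hz).trans ?_, hrep⟩
  exact mul_le_mul_of_nonneg_left (Real.exp_le_exp.2 (neg_le_neg (mul_le_mul_of_nonneg_right hκ (torusTreeLen_nonneg _)))) hE₀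

open Classical in
/-- **STRIP AT EVERY LEVEL IN EVERY COUPLING, AT THE SPACES OF RECORD, FROM THE OLDER-COUPLING LEVEL-T HYPOTHESIS + AN `EHoloAt` FAMILY** — module 8's
`stripBound_termC_of_termwise226StripOlder_lastOut` at `sp := U^c of record` with `hlast` DISCHARGED by §1: the displayed hypothesis `h226TOlder` ([II] (2.15)–(2.26) per
term read on the strip of an OLDER coupling `i < k`, node N10's lane), one `EHoloAt` per window history and step with letters `(E₀, r)` (node N09's currency;
`γ ≤ cs.γ`, `κ ≤ cs.κ`), the socket numerals `Lemma3Numerics c M (½L) …`, `8 ≤ c.L`, S25's clauses at `A := C₃ε₁`, `R := (1−8δ)½Lκ`, `κ ≤ r₁`, the renewal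
`e·9·64·K₀(64,8)²·C₃ε₁ ≤ E₀`. [cite: Balaban1988RG2Cluster, (2.26) p.17 and Lemma 3 p.20 (read on the strip); Balaban1987RG1, p.263] -/
theorem stripBound_termC_of_termwise226StripOlder_eHoloAt [NeZero M] (S : ClusterTower (F.P K) 𝔸 M) (c : B13.Consts) {L : ℕ} [NeZero L]
    (hL : 8 ≤ c.L) (hLc : c.L = L) {a a₂ a₂' a₅ Aabs : ℝ} (hN : Lemma3Numerics c M ((c.L : ℝ) / 2) a a₂ a₂' a₅ Aabs)
    {cs : SFConsts} {γ r E₀ κ r₁ : ℝ} (hr : 0 ≤ r) (hA0 : 0 ≤ c.C3act * c.ε₁) (hr₁ : 0 ≤ r₁) (hκ : κ ≤ r₁)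
    (hrate : r₁ + 2 * (64 * Real.log 162) + 2 ≤ (1 - 8 * c.δ) * ((c.L : ℝ) / 2) * c.κ)
    (hsmall : c.C3act * c.ε₁ * Real.exp (5 * r₁ + 1) * K₀ 64 8 * 9 * 64 ≤ 1)
    (hrenew : Real.exp 1 * 9 * 64 * K₀ 64 8 ^ 2 * (c.C3act * c.ε₁) ≤ E₀) (hγ : γ ≤ cs.γ) (hκc : κ ≤ cs.κ)
    (h226TOlder : ∀ (k : ℕ) (g : ℕ → ℝ), g ∈ Window γ → ∀ (i : ℕ), i < k → ∀ (X : (domSys (F.P K) M (k + 1)).Dom) (φ : CPair (F.P K) 𝔸),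
      φ ∈ spaceI Sg Rz M (k + 1) (domSites (F.P K) M (k + 1) X) cs.α₀ cs.α₁ →
      (∀ (j : ℕ), j < k + 1 → ∀ (Y : (domSys (F.P K) M j).Dom) (ψ : CPair (F.P K) 𝔸), ψ ∈ spaceI Sg Rz M j (domSites (F.P K) M j Y) cs.α₀ cs.α₁ →
        ∃ (Ec : ℂ → ℂ) (O : Set ℂ), IsOpen O ∧ (∀ t ∈ Ioc (0 : ℝ) γ, closedBall (t : ℂ) r ⊆ O) ∧ DifferentiableOn ℂ Ec O ∧
          (∀ z ∈ O, ‖Ec z‖ ≤ E₀ * Real.exp (-(κ * torusTreeLen Y.1))) ∧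
          (∀ t ∈ Ioc (0 : ℝ) γ, Ec t = termC S j Y (Function.update g i t) ψ)) →
      ∃ (Hc : ℂ → TDom 4 (domCount (F.P K) M (k + 1)) → ℂ)
        (Tt : (Z : TDom 4 (domCount (F.P K) M (k + 1))) →
          Finset (TDom 4 (L * domCount (F.P K) M (k + 1))) × Finset (TBond 4 M (L * domCount (F.P K) M (k + 1))) → ℂ → ℂ)
        (O : Set ℂ), IsOpen O ∧ (∀ t ∈ Ioc (0 : ℝ) γ, closedBall (t : ℂ) r ⊆ O) ∧
        (∀ Z : (domSys (F.P K) M (k + 1)).Dom, Z.1 ⊆ X.1 → DifferentiableOn ℂ (fun z => Hc z Z) O) ∧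
        (∀ z ∈ O, ∀ Z : TDom 4 (domCount (F.P K) M (k + 1)), Z.1 ⊆ X.1 → ‖Hc z Z‖ ≤ ∑ t ∈ terms L M Z, ‖Tt Z t z‖) ∧
        (∀ z ∈ O, ∀ Z : TDom 4 (domCount (F.P K) M (k + 1)), Z.1 ⊆ X.1 → ∀ t ∈ terms L M Z,
          ‖Tt Z t z‖ ≤ weight L M c Z a t * Real.exp (a₅ * ((Z.1).card : ℝ))) ∧
        (∀ t ∈ Ioc (0 : ℝ) γ, Hc t = (S k).H (restrictPrefix k (Function.update g i t)) φ))
    (hE : ∀ g ∈ Window γ, ∀ k : ℕ, ∃ H : EHoloAt (sfTowerOfRecord Sg Rz M S ⟨g, β⟩ logZ) cs k, H.E₀ ≤ E₀ ∧ r ≤ H.r) :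
    ∀ (j : ℕ) (g : ℕ → ℝ), g ∈ Window γ → ∀ (i : ℕ) (Y : (domSys (F.P K) M j).Dom) (ψ : CPair (F.P K) 𝔸),
      ψ ∈ spaceI Sg Rz M j (domSites (F.P K) M j Y) cs.α₀ cs.α₁ →
      ∃ (Ec : ℂ → ℂ) (O : Set ℂ), IsOpen O ∧ (∀ t ∈ Ioc (0 : ℝ) γ, closedBall (t : ℂ) r ⊆ O) ∧ DifferentiableOn ℂ Ec O ∧
        (∀ z ∈ O, ‖Ec z‖ ≤ E₀ * Real.exp (-(κ * torusTreeLen Y.1))) ∧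
        (∀ t ∈ Ioc (0 : ℝ) γ, Ec t = termC S j Y (Function.update g i t) ψ) := by
  have hM : 0 ≤ Real.exp 1 * 9 * 64 * K₀ 64 8 ^ 2 * (c.C3act * c.ε₁) := by positivity
  exact stripBound_termC_of_termwise226StripOlder_lastOut F K S (fun j Y => spaceI Sg Rz M j (domSites (F.P K) M j Y) cs.α₀ cs.α₁) c hL hLc hN hr
    hA0 hr₁ hκ hrate hsmall hrenew h226TOlder (hlast_of_eHoloAt F K Sg Rz logZ β S hγ hκc (le_trans hM hrenew) hE)

end LastCoupling

/-! ## §2 At the reading data of record: `N22At` from the older-coupling level-T hypothesis + `EHoloAt` + node N18 below -/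

section OfRecord

variable {F : T4Family} {M : ℕ} [NeZero M] (S : (k : ℕ) → ClusterTower (F.P k) (MatA N) M)
  (gauge : (k : ℕ) → GaugeField (F.P k) 0 (Node00.SU N) → GaugeField (F.P k) 0 (Node00.SU N) → ℝ) (hg : ∀ k U U', 0 ≤ gauge k U U')
  (transport : (k : ℕ) → GaugeField (F.P (k + 1)) 0 (Node00.SU N) → GaugeField (F.P k) 0 (Node00.SU N)) (li : LetterInputs)
  (θ : Stage12Params F N) (k : ℕ) {G : Type*} [GaugeGroup G]
  (Sg : Setting (MatA N) G) (Rz : Residual (F.P k) (MatA N)) (logZ : ℕ → GaugeField (F.P k) 0 G → ℝ) (β : ℕ → ℝ → ℝ)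

open Classical in
/-- **`N22At` AT THE LEVEL-`k` BUNDLE OF THE READING OF RECORD FROM NAMED NEIGHBOURS' CURRENCIES** (module 10's `n22At_u3OfRecord₁₂_ofRecord_of_n18Below_stripBound` with STRIP
supplied by §1): for `D := ReadingData.ofRecord F M N S gauge hg T₀ li` at window `]0, θ.γ]` and the space table of record `U^c_j(Y, cs.α₀, cs.α₁)` on the `k`-th
torus — readings `(ιU, 0) ∈ U^c` (Theorem 1, displayed), the OLDER-coupling level-T hypothesis for `S k` (node N10's lane, displayed), one
`EHoloAt (sfTowerOfRecord Sg Rz M (S k) ⟨g, β⟩ logZ) cs k′` per `g ∈ ]0, θ.γ]^ℕ` and `k′` with `H.E₀ ≤ li.A`, `li.r ≤ H.r` (node N09's currency, `θ.γ ≤ cs.γ`,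
`li.κ ≤ cs.κ`), `∀ k′ < k, N18At (u3OfRecord₁₂ θ (D.u3Objects θ.γ) k′)` (node N18), the junk-freeness pin (J), the socket numerals + S25 + the renewal
`e·9·64·K₀(64,8)²·C₃ε₁ ≤ li.A`, and the letter signs ⟹ `N22At (u3OfRecord₁₂ θ (D.u3Objects θ.γ) k)`. [folklore] -/
theorem n22At_u3OfRecord₁₂_ofRecord_of_n18Below_termwise226StripOlder_eHoloAt {cs : SFConsts}
    (hsp : ∀ (j : ℕ) (U : GaugeField (F.P k) 0 (Node00.SU N)) (Y : (domSys (F.P k) M j).Dom),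
      ofBackgroundC (ιSU N) U ∈ spaceI Sg Rz M j (domSites (F.P k) M j Y) cs.α₀ cs.α₁)
    (c : B13.Consts) {L : ℕ} [NeZero L] (hL : 8 ≤ c.L) (hLc : c.L = L) {a a₂ a₂' a₅ Aabs : ℝ}
    (hN : Lemma3Numerics c M ((c.L : ℝ) / 2) a a₂ a₂' a₅ Aabs) {r₁ : ℝ} (hA0 : 0 ≤ c.C3act * c.ε₁) (hr₁ : 0 ≤ r₁) (hκ : li.κ ≤ r₁)
    (hrate : r₁ + 2 * (64 * Real.log 162) + 2 ≤ (1 - 8 * c.δ) * ((c.L : ℝ) / 2) * c.κ)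
    (hsmall : c.C3act * c.ε₁ * Real.exp (5 * r₁ + 1) * K₀ 64 8 * 9 * 64 ≤ 1)
    (hrenew : Real.exp 1 * 9 * 64 * K₀ 64 8 ^ 2 * (c.C3act * c.ε₁) ≤ li.A) (hγc : θ.γ ≤ cs.γ) (hκc : li.κ ≤ cs.κ)
    (h226TOlder : ∀ (k' : ℕ) (g : ℕ → ℝ), g ∈ Window θ.γ → ∀ (i : ℕ), i < k' → ∀ (X : (domSys (F.P k) M (k' + 1)).Dom) (φ : CPair (F.P k) (MatA N)),
      φ ∈ spaceI Sg Rz M (k' + 1) (domSites (F.P k) M (k' + 1) X) cs.α₀ cs.α₁ →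
      (∀ (j : ℕ), j < k' + 1 → ∀ (Y : (domSys (F.P k) M j).Dom) (ψ : CPair (F.P k) (MatA N)), ψ ∈ spaceI Sg Rz M j (domSites (F.P k) M j Y) cs.α₀ cs.α₁ →
        ∃ (Ec : ℂ → ℂ) (O : Set ℂ), IsOpen O ∧ (∀ t ∈ Ioc (0 : ℝ) θ.γ, closedBall (t : ℂ) li.r ⊆ O) ∧ DifferentiableOn ℂ Ec O ∧
          (∀ z ∈ O, ‖Ec z‖ ≤ li.A * Real.exp (-(li.κ * torusTreeLen Y.1))) ∧
          (∀ t ∈ Ioc (0 : ℝ) θ.γ, Ec t = termC (S k) j Y (Function.update g i t) ψ)) →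
      ∃ (Hc : ℂ → TDom 4 (domCount (F.P k) M (k' + 1)) → ℂ)
        (Tt : (Z : TDom 4 (domCount (F.P k) M (k' + 1))) →
          Finset (TDom 4 (L * domCount (F.P k) M (k' + 1))) × Finset (TBond 4 M (L * domCount (F.P k) M (k' + 1))) → ℂ → ℂ)
        (O : Set ℂ), IsOpen O ∧ (∀ t ∈ Ioc (0 : ℝ) θ.γ, closedBall (t : ℂ) li.r ⊆ O) ∧
        (∀ Z : (domSys (F.P k) M (k' + 1)).Dom, Z.1 ⊆ X.1 → DifferentiableOn ℂ (fun z => Hc z Z) O) ∧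
        (∀ z ∈ O, ∀ Z : TDom 4 (domCount (F.P k) M (k' + 1)), Z.1 ⊆ X.1 → ‖Hc z Z‖ ≤ ∑ t ∈ terms L M Z, ‖Tt Z t z‖) ∧
        (∀ z ∈ O, ∀ Z : TDom 4 (domCount (F.P k) M (k' + 1)), Z.1 ⊆ X.1 → ∀ t ∈ terms L M Z,
          ‖Tt Z t z‖ ≤ weight L M c Z a t * Real.exp (a₅ * ((Z.1).card : ℝ))) ∧
        (∀ t ∈ Ioc (0 : ℝ) θ.γ, Hc t = ((S k) k').H (restrictPrefix k' (Function.update g i t)) φ))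
    (hE : ∀ g ∈ Window θ.γ, ∀ k' : ℕ, ∃ H : EHoloAt (sfTowerOfRecord Sg Rz M (S k) ⟨g, β⟩ logZ) cs k', H.E₀ ≤ li.A ∧ li.r ≤ H.r)
    (hjunk : ∀ (k : ℕ) (X : Node00.W1.Dom (F.P k) M), k < X.1 → ∀ (g : ℕ → ℝ) (φ : CPair (F.P k) (MatA N)), functionalC (S k) g φ X = 0)
    (h18 : ∀ k' : ℕ, k' < k → N18At (u3OfRecord₁₂ θ ((ReadingData.ofRecord F M N S gauge hg transport li).u3Objects θ.γ) k'))
    (hC5 : 0 ≤ li.C₅) (hθ1 : li.θ₅ < 1) (hC₀' : 2 * li.C₅ / (1 - li.θ₅) ≤ li.C₀)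
    (hC₀ : 0 < li.C₀) (hθ : 0 < li.θ₅) (hA : 0 < li.A) (hμ1 : 1 ≤ li.μ) (hθμ : li.θ₅ ≤ li.μ) (hCM : li.C₀ ≤ 2 * li.A)
    (hr : 0 < li.r) (hγ : 0 < θ.γ) (hs0 : 0 < li.s) (hs1 : li.s < 1) :
    N22At (u3OfRecord₁₂ θ ((ReadingData.ofRecord F M N S gauge hg transport li).u3Objects θ.γ) k) :=
  n22At_u3OfRecord₁₂_ofRecord_of_n18Below_stripBound S gauge hg transport li θ k
    (fun j Y => spaceI Sg Rz M j (domSites (F.P k) M j Y) cs.α₀ cs.α₁) hsp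
    (stripBound_termC_of_termwise226StripOlder_eHoloAt F k Sg Rz logZ β (S k) c hL hLc hN hr.le hA0 hr₁ hκ hrate hsmall hrenew hγc hκc h226TOlder hE)
    hjunk h18 hC5 hθ1 hC₀' hC₀ hθ hA hμ1 hθμ hCM hr hγ hs0 hs1

end OfRecord

end YMDAG.N22.W1

end
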